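import Literature.Geometry.Symplectic.OrigamiCutGlue
import Literature.Geometry.Symplectic.FoldFormsFourFoldsGlueAssembly
import HarnessLib

/-!
# The symplectic form of a cut piece (gluing the side form and the reduced form)

Proofs companion of `OrigamiUnfolding.lean` (the named fact
`Literature.Geometry.Symplectic.exists_symplecticCutPieces_of_isOrigamiForm`, Cannas da
Silva–Guillemin–Pires, *Symplectic Origami*, IMRN 2011 = arXiv:0909.4065, Prop. 2.8), step (S3)
concluded: the form `ω₀⁺` on the cut piece `M₀⁺ = M⁺ ∪_{j⁺} μ⁻¹(0)/S¹` "restricting to `ω` on `M⁺`"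
and to the reduced form on the cut (proof of Prop. 2.8: `j⁺` is a symplectomorphism, so the two
forms glue).  For `D : CutCollarData M N` (`OrigamiCutGlueMaps.lean`, the piece `D.Piece` of
`OrigamiCutGlue.lean`):

* `D.sideForm = s|_V`, `D.discForm = Ω_Q|_{cutDisc δ}` — the two forms, smooth, closed and
  non-degenerate (`discForm_nondegenerate`: at `[n, w]` from the non-degeneracy of the model form
  at `(n, |w|)`, i.e. of `s` at the collar point `c (n, |w|) ∈ V`, for `w ≠ 0`, and from
  `ker ωZ = ℝ X` on the zero section — `OrigamiCutFormKernel.lean`);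
* `D.collarV`, `D.collarB` — the collar read in the two pieces; **compatibility**
  `glue^* discForm = sideForm` (`discForm_glueFun_apply`): both pull back along the collar to
  the model form `pr₁^*ωZ + d(t² pr₁^*α)` (`D.pullback_c`, `cutForm_pullback_realSlice`);
* the glued form itself (`D.pieceForm`) is in the sequel `OrigamiCutPieceForm.lean`.

Everything here is proved; the definitions are explicit; no facts.

## References

* A. Cannas da Silva, V. Guillemin, A. R. Pires, *Symplectic Origami*, IMRN 2011 =
  arXiv:0909.4065, proof of Prop. 2.8. [CannasdasilvaGuilleminPires2010]
-/

noncomputable section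

open scoped Manifold ContDiff Topology RealInnerProductSpace
open Set Function Filter TopologicalSpace
open _root_.Topology
open Literature.Geometry.Kaehler Literature.Geometry.Manifold

namespace Literature.Geometry.Symplectic

namespace CutCollarData

universe u

variable {M : Type u} [TopologicalSpace M] [ChartedSpace (EuclideanSpace ℝ (Fin 4)) M]
  [IsManifold (𝓡 4) ∞ M]
  {N : Type} [TopologicalSpace N] [ChartedSpace (EuclideanSpace ℝ (Fin 3)) N]
  [IsManifold (𝓡 3) ∞ N] [T2Space N] [Nonempty N] [MulAction Circle N] (D : CutCollarData M N)

/-! ### The pieces are non-empty -/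

omit [IsManifold (𝓡 4) ∞ M] [IsManifold (𝓡 3) ∞ N] [T2Space N] in
/-- The side is non-empty (it contains the half collar). [folklore] -/
instance nonempty_V : Nonempty D.V :=
  ⟨⟨D.c (Classical.arbitrary N, D.δ / 2), D.c_mem _ _ ⟨half_pos D.δ_pos, half_lt_self D.δ_pos⟩⟩⟩

omit [IsManifold (𝓡 4) ∞ M] [IsManifold (𝓡 3) ∞ N] [T2Space N] in
/-- The disc bundle is non-empty. [folklore] -/
instance nonempty_B : Nonempty D.B :=
  ⟨⟨cutSlice (Classical.arbitrary N, D.clamp 0), D.cutSlice_clamp_mem _ _⟩⟩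

/-! ### The two forms -/

/-- The form of the side: the restriction of `s` to `V`. [folklore] -/
def sideForm : MForm (𝓡 4) D.V ℝ 2 := D.s.pullback (𝓡 4) (Subtype.val : D.V → M)

omit [IsManifold (𝓡 4) ∞ M] [IsManifold (𝓡 3) ∞ N] [T2Space N] [Nonempty N] in
/-- Values of the side form. [folklore] -/
@[simp] theorem sideForm_apply (a : D.V) (v : Fin 2 → TangentSpace (𝓡 4) a) :
    D.sideForm a v = D.s (a : M) v :=
  MForm.pullback_subtypeVal_apply D.s a v

omit [IsManifold (𝓡 3) ∞ N] [T2Space N] [Nonempty N] in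
/-- The side form is smooth. [folklore] -/
theorem isSmoothForm_sideForm : IsSmoothForm D.sideForm := D.smooth_s.pullback_subtypeVal

omit [IsManifold (𝓡 3) ∞ N] [T2Space N] [Nonempty N] in
/-- The side form is closed. [folklore] -/
theorem isClosedForm_sideForm : IsClosedForm D.sideForm := by
  show mextDeriv D.sideForm = 0
  funext a
  ext v
  rw [sideForm, mextDeriv_pullback_subtypeVal_apply (D.smooth_s (a : M))]
  have h0 : mextDeriv D.s = 0 := D.closed_s
  rw [h0]
  rfl

omit [IsManifold (𝓡 4) ∞ M] [IsManifold (𝓡 3) ∞ N] [T2Space N] [Nonempty N] in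
/-- The side form is non-degenerate. [folklore] -/
theorem sideForm_nondegenerate (a : D.V) (v : TangentSpace (𝓡 4) a) (hv : v ≠ 0) :
    ∃ w : TangentSpace (𝓡 4) a, D.sideForm a ![v, w] ≠ 0 := by
  obtain ⟨w, hw⟩ := D.nondeg (a : M) a.2 v hv
  exact ⟨w, by rw [sideForm_apply]; exact hw⟩

/-- The reduced form of the cut space of `D`. [folklore] -/
def redForm : letI := D.csB; MForm (𝓡 (3 + 1)) (CutSpace 3 N) ℝ 2 :=
  cutFormQ D.smooth_act D.free_act D.ωZ D.α

/-- The form of the disc bundle: the restriction of the reduced form. [folklore] -/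
def discForm : letI := D.csB; MForm (𝓡 (3 + 1)) D.B ℝ 2 :=
  letI := D.csB; D.redForm.pullback (𝓡 (3 + 1)) (Subtype.val : D.B → CutSpace 3 N)

omit [IsManifold (𝓡 4) ∞ M] [Nonempty N] in
/-- Values of the disc form. [folklore] -/
@[simp] theorem discForm_apply (b : D.B)
    (v : letI := D.csB; Fin 2 → TangentSpace (𝓡 (3 + 1)) b) :
    letI := D.csB; D.discForm b v = D.redForm (b : CutSpace 3 N) v := by
  letI := D.csB
  exact MForm.pullback_subtypeVal_apply D.redForm b v

omit [IsManifold (𝓡 4) ∞ M] [Nonempty N] in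
/-- The reduced form is smooth. [folklore] -/
theorem isSmoothForm_redForm : letI := D.csB; IsSmoothForm D.redForm := by
  letI := D.csB
  exact isSmoothForm_cutFormQ D.smooth_act D.free_act D.basic_ωZ D.smooth_ωZ D.smooth_α D.inv_α D.α_X D.basic_dα

omit [IsManifold (𝓡 4) ∞ M] [Nonempty N] in
/-- The reduced form is closed. [folklore] -/
theorem isClosedForm_redForm : letI := D.csB; IsClosedForm D.redForm := by
  letI := D.csB
  exact isClosedForm_cutFormQ D.smooth_act D.free_act D.basic_ωZ D.smooth_ωZ D.smooth_α D.inv_α D.α_X D.basic_dα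
    D.closed_ωZ

omit [IsManifold (𝓡 4) ∞ M] [Nonempty N] in
/-- The disc form is smooth. [folklore] -/
theorem isSmoothForm_discForm : letI := D.csB; IsSmoothForm D.discForm := by
  letI := D.csB
  haveI := isManifold_cutSpace D.smooth_act D.free_act
  exact D.isSmoothForm_redForm.pullback_subtypeVal

omit [IsManifold (𝓡 4) ∞ M] [Nonempty N] in
/-- The disc form is closed. [folklore] -/
theorem isClosedForm_discForm : letI := D.csB; IsClosedForm D.discForm := by
  letI := D.csB
  haveI := isManifold_cutSpace D.smooth_act D.free_act
  show mextDeriv D.discForm = 0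
  funext b
  ext v
  rw [discForm, mextDeriv_pullback_subtypeVal_apply (D.isSmoothForm_redForm (b : CutSpace 3 N))]
  have h0 : mextDeriv D.redForm = 0 := D.isClosedForm_redForm
  rw [h0]
  rfl

/-! ### Non-degeneracy of the reduced form on the disc bundle -/

omit [IsManifold (𝓡 4) ∞ M] [T2Space N] [Nonempty N] in
/-- The model form is non-degenerate at `(n, t)` for `0 < t < δ`: it is the pull-back of `s` along
the collar, whose differential is bijective, at a point of `V`. [folklore] -/
theorem model_nondegenerate (n : N) {t : ℝ} (ht : t ∈ Ioo 0 D.δ) (a : EuclideanSpace ℝ (Fin 3)) (σ : ℝ)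
    (hnull : ∀ (b : EuclideanSpace ℝ (Fin 3)) (τ : ℝ),
      D.ωZ n ![a, b] + (t ^ 2 * mextDeriv D.α n ![a, b] + 2 * t * (σ * D.α n ![b] - τ * D.α n ![a])) = 0) :
    a = 0 ∧ σ = 0 := by
  have hband : ((n, t) : N × ℝ) ∈ D.band := D.halfBand_subset_band (D.mk_mem_halfBand ht)
  -- the model form at `(n, t)` is `c^*s`
  have hmod := D.pullback_c (n, t) hband
  -- `(a, σ)` is null for `c^*s`, hence `dc (a, σ)` is null for `s` at `c (n, t) ∈ V`
  by_contra hne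
  have hV : ((a, σ) : EuclideanSpace ℝ (Fin 3) × ℝ) ≠ 0 := by
    intro h0
    apply hne
    exact ⟨congrArg Prod.fst h0, congrArg Prod.snd h0⟩
  have hbij := D.bij_c n t hband.2
  have hdc0 : mfderiv ((𝓡 3).prod 𝓘(ℝ, ℝ)) (𝓡 4) D.c (n, t) ((a, σ) : EuclideanSpace ℝ (Fin 3) × ℝ) ≠ 0 := by
    intro h0
    exact hV (hbij.1 (h0.trans (map_zero _).symm))
  obtain ⟨w, hw⟩ := D.nondeg _ (D.c_mem n t ht) _ hdc0
  obtain ⟨W, rfl⟩ := hbij.2 w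
  apply hw
  have h := congrArg (fun φ => φ ![((a, σ) : EuclideanSpace ℝ (Fin 3) × ℝ), W]) hmod
  rw [MForm.pullback_apply] at h
  have hvec : (fun i : Fin 2 => mfderiv ((𝓡 3).prod 𝓘(ℝ, ℝ)) (𝓡 4) D.c (n, t)
      (![((a, σ) : EuclideanSpace ℝ (Fin 3) × ℝ), W] i)) =
      ![mfderiv ((𝓡 3).prod 𝓘(ℝ, ℝ)) (𝓡 4) D.c (n, t) ((a, σ) : EuclideanSpace ℝ (Fin 3) × ℝ),
        mfderiv ((𝓡 3).prod 𝓘(ℝ, ℝ)) (𝓡 4) D.c (n, t) W] := by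
    funext i; fin_cases i <;> rfl
  have h2 := ((congrArg (D.s (D.c (n, t))) hvec).symm.trans h)
  refine h2.trans ?_
  rw [show W = ((W.1, W.2) : EuclideanSpace ℝ (Fin 3) × ℝ) from rfl, modelForm_apply D.ωZ D.smooth_α]
  exact hnull W.1 W.2

omit [IsManifold (𝓡 4) ∞ M] [T2Space N] [Nonempty N] in
/-- **The auxiliary form `Θ̂_{|w|²}` is non-degenerate at `n` for `|w| < δ`.** [folklore] -/
theorem aux_nondegenerate (n : N) {w : ℂ} (hw : ‖w‖ < D.δ) (a : TangentSpace (𝓡 3) n) (σ : ℝ)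
    (hnull : ∀ (b : TangentSpace (𝓡 3) n) (τ : ℝ),
      D.ωZ n ![a, b] + ‖w‖ ^ 2 * mextDeriv D.α n ![a, b] + (σ * D.α n ![b] - τ * D.α n ![a]) = 0) :
    a = 0 ∧ σ = 0 := by
  by_cases h0 : w = 0
  · subst h0
    exact aux_nondegenerate_zero (D.ωZ n) (mextDeriv D.α n) (D.α n) (circleFundVec n)
      (fun b => D.basic_ωZ.horizontal n ![circleFundVec n, b] 0 rfl) (D.α_X n) (D.ker_ωZ n) a σ hnull
  · have ht : ‖w‖ ∈ Ioo 0 D.δ := ⟨norm_pos_iff.2 h0, hw⟩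
    exact aux_nondegenerate_of_model (D.ωZ n) (mextDeriv D.α n) (D.α n) (norm_ne_zero_iff.2 h0)
      (D.model_nondegenerate n ht) a σ hnull

omit [IsManifold (𝓡 4) ∞ M] [Nonempty N] in
/-- **The reduced form is non-degenerate on the disc bundle.** [cite: CannasdasilvaGuilleminPires2010, Prop. 2.8] -/
theorem redForm_nondegenerate (q : CutSpace 3 N) (hq : q ∈ (D.B : Set (CutSpace 3 N)))
    (u : letI := D.csB; TangentSpace (𝓡 (3 + 1)) q) (hu : u ≠ 0) :
    letI := D.csB; ∃ u' : TangentSpace (𝓡 (3 + 1)) q, D.redForm q ![u, u'] ≠ 0 := by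
  letI := D.csB
  obtain ⟨n, w, rfl⟩ := cutMk_surjective q
  have hw : ‖w‖ < D.δ := (cutMk_mem_cutDisc_iff D.δ_pos).1 hq
  exact cutFormQ_nondegenerate_at D.smooth_act D.free_act D.basic_ωZ D.smooth_α D.inv_α D.α_X D.basic_dα
    n w (D.aux_nondegenerate n hw) u hu

omit [IsManifold (𝓡 4) ∞ M] [Nonempty N] in
/-- The disc form is non-degenerate. [folklore] -/
theorem discForm_nondegenerate (b : D.B) (u : letI := D.csB; TangentSpace (𝓡 (3 + 1)) b) (hu : u ≠ 0) :
    letI := D.csB; ∃ u' : TangentSpace (𝓡 (3 + 1)) b, D.discForm b ![u, u'] ≠ 0 := by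
  letI := D.csB
  obtain ⟨u', h⟩ := D.redForm_nondegenerate (b : CutSpace 3 N) b.2 u hu
  exact ⟨u', by rw [discForm_apply]; exact h⟩

/-! ### The collar in the two pieces; compatibility -/

/-- The collar read in the side: `(n, t) ↦ c (n, clamp t) ∈ V`. [folklore] -/
def collarV (q : N × ℝ) : D.V := ⟨D.c (q.1, D.clamp q.2), D.c_mem _ _ (D.clamp_mem _)⟩

/-- The collar read in the disc bundle: `(n, t) ↦ [n, clamp t]`. [folklore] -/
def collarB (q : N × ℝ) : D.B := ⟨cutSlice (q.1, D.clamp q.2), D.cutSlice_clamp_mem _ _⟩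

omit [IsManifold (𝓡 4) ∞ M] [IsManifold (𝓡 3) ∞ N] [T2Space N] [Nonempty N] in
/-- On the half band the side collar is `c`. [folklore] -/
theorem coe_collarV {q : N × ℝ} (hq : q ∈ D.halfBand) : (D.collarV q : M) = D.c q := by
  show D.c (q.1, D.clamp q.2) = D.c q
  rw [D.clamp_of_mem hq.2]

omit [IsManifold (𝓡 4) ∞ M] [IsManifold (𝓡 3) ∞ N] [T2Space N] [Nonempty N] in
/-- On the half band the disc collar is the real slice. [folklore] -/
theorem coe_collarB {q : N × ℝ} (hq : q ∈ D.halfBand) : (D.collarB q : CutSpace 3 N) = cutSlice q := by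
  show cutSlice (k := 3) (q.1, D.clamp q.2) = cutSlice q
  rw [D.clamp_of_mem hq.2]

omit [IsManifold (𝓡 4) ∞ M] [IsManifold (𝓡 3) ∞ N] [T2Space N] [Nonempty N] in
/-- The side collar lands in the source of the gluing. [folklore] -/
theorem collarV_mem_source {q : N × ℝ} (hq : q ∈ D.halfBand) : D.collarV q ∈ D.glueSource :=
  ⟨q, hq, (D.coe_collarV hq).symm⟩

omit [IsManifold (𝓡 4) ∞ M] [IsManifold (𝓡 3) ∞ N] [T2Space N] in
/-- `glue ∘ collarV = collarB` on the half band. [folklore] -/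
theorem glueFun_collarV {q : N × ℝ} (hq : q ∈ D.halfBand) : D.glueFun (D.collarV q) = D.collarB q := by
  apply Subtype.ext
  obtain ⟨n, t⟩ := q
  have hV : D.c (n, t) ∈ (D.V : Set M) := D.c_mem n t hq.2
  have h1 : D.collarV (n, t) = ⟨D.c (n, t), hV⟩ := Subtype.ext (D.coe_collarV hq)
  rw [h1, D.glueFun_apply hq.2 hV, D.coe_collarB hq]

/-- A corestriction `g` of a map `f` to an open submanifold (`Subtype.val ∘ g = f`) has the
derivatives of `f` (variant of the tree's `hasMFDerivAt_codRestrict_opens`, stated with a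
composition hypothesis; Lee (2013), Prop. 3.9). [folklore] -/
theorem hasMFDerivAt_codRestrict_of_comp_eq {EX HX : Type*} [NormedAddCommGroup EX] [NormedSpace ℝ EX]
    [TopologicalSpace HX] {IX : ModelWithCorners ℝ EX HX} {X : Type*} [TopologicalSpace X]
    [ChartedSpace HX X] {EY HY : Type*} [NormedAddCommGroup EY] [NormedSpace ℝ EY]
    [TopologicalSpace HY] {IY : ModelWithCorners ℝ EY HY} {Y : Type*} [TopologicalSpace Y]
    [ChartedSpace HY Y] {U' : Opens Y} {f : X → Y} {g : X → U'} (hfg : Subtype.val ∘ g = f)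
    {x : X} {f' : EX →L[ℝ] EY} (hf : HasMFDerivAt IX IY f x f') : HasMFDerivAt IX IY g x f' := by
  subst hfg
  refine ⟨?_, ?_⟩
  · rw [Topology.IsInducing.subtypeVal.continuousAt_iff]
    exact hf.1
  · have heq : writtenInExtChartAt IX IY x g = writtenInExtChartAt IX IY x (Subtype.val ∘ g) := by
      funext z
      simp only [writtenInExtChartAt, Function.comp_apply, extChartAt_coe,
        TopologicalSpace.Opens.chartAt_eq, OpenPartialHomeomorph.subtypeRestr_coe, restrict_apply]
    rw [heq]
    exact hf.2

omit [IsManifold (𝓡 4) ∞ M] [IsManifold (𝓡 3) ∞ N] [T2Space N] [Nonempty N] in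
/-- The side collar is `C^∞` on the half band, with the differential of `c`. [folklore] -/
theorem hasMFDerivAt_collarV {q : N × ℝ} (hq : q ∈ D.halfBand) :
    HasMFDerivAt ((𝓡 3).prod 𝓘(ℝ, ℝ)) (𝓡 4) D.collarV q (mfderiv ((𝓡 3).prod 𝓘(ℝ, ℝ)) (𝓡 4) D.c q) := by
  have hc : HasMFDerivAt ((𝓡 3).prod 𝓘(ℝ, ℝ)) (𝓡 4) D.c q (mfderiv ((𝓡 3).prod 𝓘(ℝ, ℝ)) (𝓡 4) D.c q) :=
    ((D.smooth_c.contMDiffAt (D.isOpen_band.mem_nhds (D.halfBand_subset_band hq))).mdifferentiableAt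
      (by simp)).hasMFDerivAt
  -- `collarV` agrees with the corestriction of `c` near `q`
  have hc' : HasMFDerivAt ((𝓡 3).prod 𝓘(ℝ, ℝ)) (𝓡 4) (fun q' : N × ℝ => D.c (q'.1, D.clamp q'.2)) q
      (mfderiv ((𝓡 3).prod 𝓘(ℝ, ℝ)) (𝓡 4) D.c q) := by
    refine hc.congr_of_eventuallyEq ?_
    filter_upwards [D.isOpen_halfBand.mem_nhds hq] with q' hq'
    show D.c (q'.1, D.clamp q'.2) = D.c q'
    rw [D.clamp_of_mem hq'.2]
  exact hasMFDerivAt_codRestrict_of_comp_eq rfl hc'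

omit [IsManifold (𝓡 4) ∞ M] [IsManifold (𝓡 3) ∞ N] [T2Space N] [Nonempty N] in
/-- The side collar is `C^∞` on the half band. [folklore] -/
theorem contMDiffOn_collarV : ContMDiffOn ((𝓡 3).prod 𝓘(ℝ, ℝ)) (𝓡 4) ∞ D.collarV D.halfBand := by
  have h : ContMDiffOn ((𝓡 3).prod 𝓘(ℝ, ℝ)) (𝓡 4) ∞ (fun q : N × ℝ => D.c (q.1, D.clamp q.2)) D.halfBand :=
    (D.smooth_c.mono D.halfBand_subset_band).congr fun q hq => by
      show D.c (q.1, D.clamp q.2) = D.c q; rw [D.clamp_of_mem hq.2]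
  intro q hq
  exact (ContMDiffWithinAt.subtypeVal_comp_iff D.V D.collarV D.halfBand q).1 (h q hq)

omit [IsManifold (𝓡 4) ∞ M] [Nonempty N] in
/-- The disc collar is `C^∞` on the half band. [folklore] -/
theorem contMDiffOn_collarB : letI := D.csB;
    ContMDiffOn ((𝓡 3).prod 𝓘(ℝ, ℝ)) (𝓡 (3 + 1)) ∞ D.collarB D.halfBand := by
  letI := D.csB
  have h : ContMDiffOn ((𝓡 3).prod 𝓘(ℝ, ℝ)) (𝓡 (3 + 1)) ∞
      (fun q : N × ℝ => (cutSlice (k := 3) (q.1, D.clamp q.2) : CutSpace 3 N)) D.halfBand :=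
    (contMDiff_cutSlice D.smooth_act D.free_act).contMDiffOn.congr fun q hq => by
      show cutSlice (k := 3) (q.1, D.clamp q.2) = cutSlice q; rw [D.clamp_of_mem hq.2]
  intro q hq
  exact (ContMDiffWithinAt.subtypeVal_comp_iff D.B D.collarB D.halfBand q).1 (h q hq)

omit [IsManifold (𝓡 4) ∞ M] [IsManifold (𝓡 3) ∞ N] [T2Space N] [Nonempty N] in
/-- **Both forms pull back along the collar to the model form**, I: the side form.
[cite: CannasdasilvaGuilleminPires2010, Prop. 2.8] -/
theorem pullback_sideForm_collarV {q : N × ℝ} (hq : q ∈ D.halfBand) :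
    (D.sideForm.pullback ((𝓡 3).prod 𝓘(ℝ, ℝ)) D.collarV) q =
      (D.ωZ.pullback ((𝓡 3).prod 𝓘(ℝ, ℝ)) (Prod.fst : N × ℝ → N) +
        mextDeriv ((fun q : N × ℝ => q.2 ^ 2) • D.α.pullback ((𝓡 3).prod 𝓘(ℝ, ℝ)) (Prod.fst : N × ℝ → N))) q := by
  rw [← D.pullback_c q (D.halfBand_subset_band hq)]
  ext V
  rw [MForm.pullback_apply, MForm.pullback_apply, sideForm_apply, (D.hasMFDerivAt_collarV hq).mfderiv]
  exact MForm.apply_congr_point' D.s (D.coe_collarV hq) _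

omit [IsManifold (𝓡 4) ∞ M] [Nonempty N] in
/-- **Both forms pull back along the collar to the model form**, II: the disc form.
[cite: CannasdasilvaGuilleminPires2010, Prop. 2.8] -/
theorem pullback_discForm_collarB {q : N × ℝ} (hq : q ∈ D.halfBand) :
    letI := D.csB
    (D.discForm.pullback ((𝓡 3).prod 𝓘(ℝ, ℝ)) D.collarB) q =
      (D.ωZ.pullback ((𝓡 3).prod 𝓘(ℝ, ℝ)) (Prod.fst : N × ℝ → N) +
        mextDeriv ((fun q : N × ℝ => q.2 ^ 2) • D.α.pullback ((𝓡 3).prod 𝓘(ℝ, ℝ)) (Prod.fst : N × ℝ → N))) q := by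
  letI := D.csB
  haveI := isManifold_cutSpace D.smooth_act D.free_act
  -- `discForm.pullback collarB = redForm.pullback (val ∘ collarB) = redForm.pullback cutSlice` near `q`
  have h1 : (D.discForm.pullback ((𝓡 3).prod 𝓘(ℝ, ℝ)) D.collarB) q =
      (D.redForm.pullback ((𝓡 3).prod 𝓘(ℝ, ℝ)) (Subtype.val ∘ D.collarB)) q :=
    MForm.pullback_pullback_apply D.redForm
      (Literature.Geometry.Manifold.OpenSubmanifold.mdifferentiableAt_subtype_val _)
      ((D.contMDiffOn_collarB.contMDiffAt (D.isOpen_halfBand.mem_nhds hq)).mdifferentiableAt (by simp))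
  have h2 : (D.redForm.pullback ((𝓡 3).prod 𝓘(ℝ, ℝ)) (Subtype.val ∘ D.collarB)) q =
      (D.redForm.pullback ((𝓡 3).prod 𝓘(ℝ, ℝ)) (cutSlice : N × ℝ → CutSpace 3 N)) q := by
    refine MForm.pullback_congr_map D.redForm ?_
    filter_upwards [D.isOpen_halfBand.mem_nhds hq] with q' hq'
    exact D.coe_collarB hq'
  have h3 : (D.redForm.pullback ((𝓡 3).prod 𝓘(ℝ, ℝ)) (cutSlice : N × ℝ → CutSpace 3 N)) q =
      ((D.redForm.pullback (𝓡 (3 + 2)) (circleQuotientMk : ProdC 3 N → CutSpace 3 N)).pullback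
        ((𝓡 3).prod 𝓘(ℝ, ℝ)) (realSlice 3 N)) q :=
    (MForm.pullback_pullback_apply D.redForm
      (((contMDiff_circleQuotientMk_prodC D.smooth_act D.free_act) _).mdifferentiableAt (by simp))
      ((contMDiff_realSlice (k := 3) (N := N) q).mdifferentiableAt (by simp))).symm
  rw [h1, h2, h3, redForm, pullback_cutFormQ D.smooth_act D.free_act D.basic_ωZ D.smooth_α D.inv_α D.α_X
    D.basic_dα, cutForm_pullback_realSlice D.ωZ D.smooth_α]

/-- **Compatibility of the two forms under the gluing**: `discForm (glue a) (dglue u, dglue u') =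
sideForm a (u, u')` on the source. [cite: CannasdasilvaGuilleminPires2010, Prop. 2.8] -/
theorem discForm_glueFun_apply {a : D.V} (ha : a ∈ D.glueSource) (u u' : TangentSpace (𝓡 4) a) :
    letI := D.csB
    D.discForm (D.glueFun a) ![mfderiv (𝓡 4) (𝓡 (3 + 1)) D.glueFun a u,
      mfderiv (𝓡 4) (𝓡 (3 + 1)) D.glueFun a u'] = D.sideForm a ![u, u'] := by
  letI := D.csB
  haveI := isManifold_cutSpace D.smooth_act D.free_act
  obtain ⟨q, hq, ha'⟩ := ha
  have haeq : a = D.collarV q := Subtype.ext (by rw [D.coe_collarV hq]; exact ha'.symm)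
  subst haeq
  -- lift `u`, `u'` along the surjective differential of the collar
  have hsurj : Surjective (mfderiv ((𝓡 3).prod 𝓘(ℝ, ℝ)) (𝓡 4) D.collarV q) := by
    rw [(D.hasMFDerivAt_collarV hq).mfderiv]
    exact (D.bij_c q.1 q.2 (D.halfBand_subset_band hq).2).2
  obtain ⟨U, rfl⟩ := hsurj u
  obtain ⟨U', rfl⟩ := hsurj u'
  -- chain rule `d(glue ∘ collarV) = d collarB`
  have hgd : MDifferentiableAt (𝓡 4) (𝓡 (3 + 1)) D.glueFun (D.collarV q) :=
    (D.contMDiffOn_glueFun.contMDiffAt (D.isOpen_glueSource.mem_nhds (D.collarV_mem_source hq))).mdifferentiableAt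
      (by simp)
  have hcd : MDifferentiableAt ((𝓡 3).prod 𝓘(ℝ, ℝ)) (𝓡 4) D.collarV q :=
    (D.contMDiffOn_collarV.contMDiffAt (D.isOpen_halfBand.mem_nhds hq)).mdifferentiableAt (by simp)
  have hcomp : ∀ W, mfderiv (𝓡 4) (𝓡 (3 + 1)) D.glueFun (D.collarV q)
      (mfderiv ((𝓡 3).prod 𝓘(ℝ, ℝ)) (𝓡 4) D.collarV q W) =
      mfderiv ((𝓡 3).prod 𝓘(ℝ, ℝ)) (𝓡 (3 + 1)) D.collarB q W := by
    intro W
    have h := mfderiv_comp q hgd hcd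
    have heq : mfderiv ((𝓡 3).prod 𝓘(ℝ, ℝ)) (𝓡 (3 + 1)) (D.glueFun ∘ D.collarV) q =
        mfderiv ((𝓡 3).prod 𝓘(ℝ, ℝ)) (𝓡 (3 + 1)) D.collarB q := by
      refine Filter.EventuallyEq.mfderiv_eq ?_
      filter_upwards [D.isOpen_halfBand.mem_nhds hq] with q' hq'
      exact D.glueFun_collarV hq'
    rw [← heq, h]
    rfl
  rw [hcomp, hcomp, D.glueFun_collarV hq]
  -- both sides are the model form on `(U, U')`
  have hB := congrArg (fun φ => φ ![U, U']) (D.pullback_discForm_collarB hq)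
  have hA := congrArg (fun φ => φ ![U, U']) (D.pullback_sideForm_collarV hq)
  rw [MForm.pullback_apply] at hA hB
  have hvA : (fun i : Fin 2 => mfderiv ((𝓡 3).prod 𝓘(ℝ, ℝ)) (𝓡 4) D.collarV q (![U, U'] i)) =
      ![mfderiv ((𝓡 3).prod 𝓘(ℝ, ℝ)) (𝓡 4) D.collarV q U, mfderiv ((𝓡 3).prod 𝓘(ℝ, ℝ)) (𝓡 4) D.collarV q U'] := by
    funext i; fin_cases i <;> rfl
  have hvB : (fun i : Fin 2 => mfderiv ((𝓡 3).prod 𝓘(ℝ, ℝ)) (𝓡 (3 + 1)) D.collarB q (![U, U'] i)) =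
      ![mfderiv ((𝓡 3).prod 𝓘(ℝ, ℝ)) (𝓡 (3 + 1)) D.collarB q U,
        mfderiv ((𝓡 3).prod 𝓘(ℝ, ℝ)) (𝓡 (3 + 1)) D.collarB q U'] := by
    funext i; fin_cases i <;> rfl
  rw [hvA] at hA
  rw [hvB] at hB
  rw [hA, hB]

end CutCollarData

end Literature.Geometry.Symplectic

end
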